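import Literature.Topology.FourManifolds.InteriorManifold
import Literature.Topology.FourManifolds.SmoothEmbeddingCriteria
import HarnessLib

/-!
# Smooth embeddings into the interior are smooth embeddings into the manifold with boundary

Topic `Literature/Topology/FourManifolds` (infrastructure for the fact seat of
`Literature.Topology.FourManifolds.HomotopySphere.exists_highlyConnected_of_mem_signatureSet`,
brick B8-I).  The interior `M ∖ bM` of a `C^∞` manifold with boundary carries the structure of a
boundaryless manifold modelled on the model vector space `E` (`InteriorManifold I M`,
Bröcker–Jänich (1982), (13.3)), and its inclusion `val` is a smooth embedding
(`InteriorManifold.isSmoothEmbedding_val`).  Mathlib has no composition of smooth embeddings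
(`proof_wanted Manifold.IsSmoothEmbedding.comp`), and the tree's composition lemmas require
equal models; here we prove the composition needed to push tubular neighbourhoods constructed
in the interior (boundaryless calculus: inverse function theorem, local diffeomorphisms) back
into the manifold with boundary:

* `InteriorManifold.isSmoothEmbedding_val_comp` — for a boundaryless source `A` (model `IA` on
  `EA ≃L E`), an OPEN smooth embedding `g : A → InteriorManifold I M` composed with `val` is a
  smooth embedding `A → M` for the models `IA`, `I` (chart bookkeeping: at `a`, the chart of `A`
  transported from the chart of `M` at `(g a).val` through `g` and the interior chart, in which
  `val ∘ g` reads `u ↦ L u`);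
* `InteriorManifold.isOpen_range_val_comp` — its range is open.

Everything is proved; no definitions, no named facts.

## References

* T. Bröcker, K. Jänich, *Introduction to Differential Topology* (1982), (13.3).
  [BrockerJanich1982]
* J. M. Lee, *Introduction to Smooth Manifolds* (2013), Prop. 4.8, Prop. 5.2.
  [LeeSmoothManifolds2013]
-/

open scoped Manifold ContDiff Topology
open Set Function OpenPartialHomeomorph Topology

noncomputable section

namespace Literature.Topology.FourManifolds

namespace InteriorManifold

universe u

variable {EA HA : Type*} [NormedAddCommGroup EA] [NormedSpace ℝ EA] [TopologicalSpace HA]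
  {IA : ModelWithCorners ℝ EA HA} [IA.Boundaryless]
  {A : Type*} [TopologicalSpace A] [ChartedSpace HA A] [IsManifold IA ∞ A]
  {E H : Type*} [NormedAddCommGroup E] [NormedSpace ℝ E] [TopologicalSpace H]
  {I : ModelWithCorners ℝ E H} {M : Type u} [TopologicalSpace M] [ChartedSpace H M]
  [IsManifold I ∞ M]

/-- The range of `val ∘ g` is open when `g` has open range in the interior. [folklore] -/
theorem isOpen_range_val_comp {B : Type*} {g : B → InteriorManifold I M} (hgo : IsOpen (range g)) :
    IsOpen (range (val ∘ g)) := by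
  rw [range_comp]
  exact isOpenMap_val _ hgo

/-- **An open smooth embedding into the interior, followed by the inclusion of the interior, is
a smooth embedding into the manifold with boundary** (models `IA` boundaryless on `EA ≃L E`,
and `I` on `M`).  Bröcker–Jänich (1982), (13.3); Lee (2013), Prop. 4.8 / 5.2 (local
diffeomorphisms preserve the smooth structure, so the transported chart lies in the maximal
atlas). [cite: BrockerJanich1982, (13.3)] -/
theorem isSmoothEmbedding_val_comp {g : A → InteriorManifold I M}
    (hg : Manifold.IsSmoothEmbedding IA 𝓘(ℝ, E) ∞ g) (hgo : IsOpen (range g))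
    (L : EA ≃L[ℝ] E) :
    Manifold.IsSmoothEmbedding IA I ∞ (val ∘ g) := by
  have hge : IsOpenEmbedding g := ⟨hg.isEmbedding, hgo⟩
  have hj : IsOpenEmbedding (val ∘ g) := isOpenEmbedding_val.comp hge
  refine ⟨Manifold.IsImmersionOfComplement.isImmersion (F := PUnit.{1}) fun a => ?_,
    hj.isEmbedding⟩
  haveI : Nonempty A := ⟨a⟩
  -- the charts: `e₁ = g` as a partial homeomorphism, `χ` the interior chart at `g a`,
  -- `ψ` the chart of `M` at `(g a).val`, `T : E ≃ₜ HA` the model change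
  set e₁ : OpenPartialHomeomorph A (InteriorManifold I M) := hge.toOpenPartialHomeomorph g
    with he₁
  set χ : OpenPartialHomeomorph (InteriorManifold I M) E := interiorChart (g a) with hχ
  set ψ : OpenPartialHomeomorph M H := chartAt H (g a).val with hψ
  set T : E ≃ₜ HA := L.symm.toHomeomorph.trans IA.toHomeomorph.symm with hT
  set φ : OpenPartialHomeomorph A HA := (e₁ ≫ₕ χ).transHomeomorph T with hφ
  have he₁src : e₁.source = univ := hge.toOpenPartialHomeomorph_source
  have he₁app : ∀ x, e₁ x = g x := fun x => rfl
  have he₁tgt : e₁.target = range g := hge.toOpenPartialHomeomorph_target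
  have he₁inv : ∀ x, e₁.symm (g x) = x := fun x => hge.toOpenPartialHomeomorph_left_inv
  have hTapp : ∀ y, T y = IA.symm (L.symm y) := fun y => rfl
  have hTsymm : ∀ h, T.symm h = L (IA h) := fun h => rfl
  have hφapp : ∀ x, φ x = IA.symm (L.symm (χ (g x))) := fun x => rfl
  have hφsrc : φ.source = {x | (g x).val ∈ ψ.source} := by
    ext x
    simp only [hφ, transHomeomorph_source, trans_source, he₁src, univ_inter, mem_preimage, he₁app,
      hχ, interiorChart_source, mem_setOf_eq, hψ]
  have hφtgt : ∀ h, h ∈ φ.target ↔ L (IA h) ∈ χ.target ∧ χ.symm (L (IA h)) ∈ range g := by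
    intro h
    simp only [hφ, transHomeomorph_target, mem_preimage, trans_target, mem_inter_iff, hTsymm,
      he₁tgt]
  have hφsymm : ∀ h, h ∈ φ.target → φ.symm h = e₁.symm (χ.symm (L (IA h))) := fun h _ => rfl
  -- smoothness of `φ` and `φ.symm`: `φ` lies in the maximal atlas of `A`
  have hφatlas : φ ∈ IsManifold.maximalAtlas IA ∞ A := by
    refine φ.mem_maximalAtlas_of_contMDiffOn ?_ ?_
    · -- `φ = IA.symm ∘ L.symm ∘ χ ∘ g`
      have h1 : ContMDiffOn IA 𝓘(ℝ, E) ∞ (χ ∘ g) φ.source := by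
        refine (contMDiffOn_chart (x := g a)).comp hg.contMDiff.contMDiffOn fun x hx => ?_
        rw [hφsrc] at hx
        simpa [hχ, chartAt_eq] using hx
      have h2 : ContMDiff 𝓘(ℝ, E) IA ∞ (IA.symm ∘ L.symm) :=
        contMDiff_modelWithCorners_symm.comp L.symm.toContinuousLinearMap.contMDiff
      exact (h2.comp_contMDiffOn h1).congr fun x _ => hφapp x
    · -- `φ.symm = e₁.symm ∘ χ.symm ∘ L ∘ IA`
      have h1 : ContMDiff IA 𝓘(ℝ, E) ∞ (L ∘ IA) := L.toContinuousLinearMap.contMDiff.comp IA.contMDiff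
      have h2 : ContMDiffOn 𝓘(ℝ, E) 𝓘(ℝ, E) ∞ χ.symm χ.target := contMDiffOn_chart_symm (x := g a)
      have h3 : ContMDiffOn 𝓘(ℝ, E) IA ∞ e₁.symm (range g) :=
        contMDiffOn_symm_of_isSmoothEmbedding hg hge
      have h12 : ContMDiffOn IA 𝓘(ℝ, E) ∞ (χ.symm ∘ L ∘ IA) φ.target :=
        h2.comp h1.contMDiffOn fun h hh => ((hφtgt h).1 hh).1
      have h123 : ContMDiffOn IA IA ∞ (e₁.symm ∘ χ.symm ∘ L ∘ IA) φ.target :=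
        h3.comp h12 fun h hh => ((hφtgt h).1 hh).2
      exact h123.congr fun h hh => hφsymm h hh
  -- the written form: `ψ.extend I ∘ (val ∘ g) ∘ (φ.extend IA).symm = L` on the target
  refine Manifold.IsImmersionAtOfComplement.mk_of_charts
    ((ContinuousLinearEquiv.prodUnique ℝ EA PUnit.{1}).trans L) φ ψ ?_ (mem_chart_source H _)
    hφatlas (IsManifold.chart_mem_maximalAtlas (g a).val) ?_ ?_
  · rw [hφsrc]; exact mem_chart_source H (g a).val
  · intro x hx
    rw [hφsrc] at hx
    exact hx
  · intro u hu
    rw [extend_target] at hu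
    obtain ⟨hu1, -⟩ := hu
    rw [mem_preimage] at hu1
    obtain ⟨hLu, hgu⟩ := (hφtgt _).1 hu1
    rw [IA.right_inv (by rw [IA.range_eq_univ]; exact mem_univ u)] at hLu hgu
    have hsymm : (φ.extend IA).symm u = e₁.symm (χ.symm (L u)) := by
      rw [extend_coe_symm, comp_apply, hφsymm _ hu1,
        IA.right_inv (by rw [IA.range_eq_univ]; exact mem_univ u)]
    obtain ⟨x, hx⟩ := hgu
    simp only [comp_apply, hsymm, ContinuousLinearEquiv.trans_apply,
      ContinuousLinearEquiv.prodUnique_apply]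
    rw [← hx, he₁inv x, hx, hχ, interiorChart_symm_apply_val (g a) (by rwa [hχ] at hLu),
      extend_coe, comp_apply, ← hψ]
    have hLu' : L u ∈ (ψ.extend I).target := interiorChart_target_subset (g a) (by rwa [hχ] at hLu)
    have := (ψ.extend I).right_inv hLu'
    rw [extend_coe] at this
    exact this

end InteriorManifold

end Literature.Topology.FourManifolds
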